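import Summits.BirchSwinnertonDyer.BirchSwinnertonDyer.Theorems.ClassRecordThreeHsiehDescentOfInertialReciprocity
import Summits.BirchSwinnertonDyer.BirchSwinnertonDyer.Theorems.ClassRecordThreeOpenValueReciprocityOfBDP
import HarnessLib

/-!
# Routes `ClassRecordThree` ∕ `KolyvaginRoadThree`, crux `HsiehDescentAtThree` (item stmt-BirchSwinnertonDyer-19108):
# the crux ⟺ its INERTIAL archimedean input (modulo the printed Tate–Sen theorem), and item 19281 ⟹ that input

Cell `bsd-stepL`, seat `bsd-stepL-desc3-p1` (prover g2), `--supports stmt-BirchSwinnertonDyer-19108`. Sequel of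
`ClassRecordThreeHsiehDescentOfInertialReciprocity` (the per-curve iff `hsiehDescentAt₃_iff_inertialReciprocity`).

* `classRecordThree_hsiehDescentAtThree_of_tateSenInertia_of_inertialReciprocity` (+ `kolyvaginRoadThree_…`): the crux
  from {`TateSenInertiaVanishing 3`, inertial value reciprocity at every elliptic `W`}.
* `classRecordThree_hsiehDescentAtThree_iff_inertialReciprocity`: modulo `TateSenInertiaVanishing 3` the crux is
  EQUIVALENT to the same two-locus statement with the node replaced by inertial value reciprocity — the archimedean
  child in inertial form carries NO SURPLUS over the crux (cf. zhang3-p1's crux-iff-leaf for 19574).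
* `inertialReciprocity_of_openValueReciprocityAtThree`: item 19281 (SHARP K5-B on `G_{ℚ₃(μ_m)}`) implies the inertial
  input at every globally minimal `W` — the inertial form is WEAKER than the landed child, so p420148 ∕ p421735 transfer.
* `classRecordThree_hsiehDescentAtThree_of_tateSenInertia_of_bdp2013`: end state with the inertia-form fact — the crux
  from {`TateSenInertiaVanishing 3`, `bertoliniDarmonPrasanna2013_centralValue_reciprocity`}.

For the planner (D-0014, said in the release note, not done here): 19281 MAY be restated to the weaker inertial form
(S30-e's conclusion under `∀ W [W.IsElliptic]`), and 19238 to `TateSenInertiaVanishing 3`; then crux 19108 ⟺ its two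
children's conjunction's archimedean part, modulo the printed theorem. HONEST FRAMING: conditional theorems + an iff;
nothing discharged; item 19108 OPEN; no census word (T7).

References: [BrinonConrad2009] Thm. 2.2.7; [BertoliniDarmonPrasanna2013] Thm. 5.5, (5.1.16), Prop. 1.12 (1);
[Hsieh2014] Thm. 1; tree S30-e `X11b/Three/LocalExactnessOfDescent.lean`.
-/

noncomputable section

open scoped NumberField Topology
open Filter NumberField IsDedekindDomain Field PowerSeries WeierstrassCurve
open Literature.NumberTheory.GaloisRepresentations Literature.NumberTheory.EllipticCurves
open Literature.NumberTheory.EllipticCurves.ModularForms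
open Literature.NumberTheory.EllipticCurves.Rank1Residual (Surj Ram)
open Summit.BirchSwinnertonDyer.Rank1Residual Summit.BirchSwinnertonDyer.Rank1Residual.X11b
open Summit.BirchSwinnertonDyer.Rank1Residual.X11b.Three
open Summit.BirchSwinnertonDyer.Rank1Residual.X11b.LambdaSupply
open Summit.BirchSwinnertonDyer.Rank1Residual.X11b.Three.LambdaSupply
open Summit.BirchSwinnertonDyer.Rank1Residual.X11b.PadicComplexTransport (continuous_algEquiv
  mem_unrIntegers_of_forall_inertia_fixed_family mem_fracUnr_of_forall_inertia_fixed_family)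
open Summit.BirchSwinnertonDyer.Rank1Residual.X11b.Three.RangeTransport
open Literature.NumberTheory.PAdicHodge (TateSenCharacterVanishing TateSenInertiaVanishing)

namespace Summit.BirchSwinnertonDyer.BirchSwinnertonDyer.Theorems

/-! ### The route items: crux `HsiehDescentAtThree` (19108) ⟺ its inertial archimedean input; 19281 ⟹ it -/

/-- **Crux `HsiehDescentAtThree` (item 19108, routes `ClassRecordThree` ∕ `KolyvaginRoadThree`) from {the printed
Tate–Sen theorem in inertia form, inertial value reciprocity at every elliptic `W`}.** CONDITIONAL on both; item
19108 stays OPEN; no class of atom O2@3, no census word. [cite: BrinonConrad2009, Thm. 2.2.7] -/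
theorem classRecordThree_hsiehDescentAtThree_of_tateSenInertia_of_inertialReciprocity
    (hTS : TateSenInertiaVanishing 3)
    (hVR : ∀ (W : WeierstrassCurve ℚ) [W.IsElliptic],
  ∀ (ι' : PadicAlgCl 3 ≃+* ℂ) (K : Type) [Field K] [NumberField K]
      (𝔭 : HeightOneSpectrum (𝓞 K)) (κ : ZpExtension K 3) (γ : Field.absoluteGaloisGroup K)
      {N : ℕ} [NeZero N] {f : CuspForm (CongruenceSubgroup.Gamma0 N) 2}, IsNewformOf W f →
      ClassX11b W 3 → Surj W 3 → W.conductorNorm ℤ = N → IsImaginaryQuadratic K →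
      Odd (NumberField.discr K) → SatisfiesHeegnerHypothesis N K →
      ((Ideal.span {(3 : ℤ)}).primesOver (𝓞 K)).ncard = 2 → ((3 : ℕ) : 𝓞 K) ∈ 𝔭.asIdeal →
      𝔭.asIdeal.ramificationIdx (𝓞 ℚ) = 1 → 𝔭.asIdeal.inertiaDeg (𝓞 ℚ) = 1 →
      (∀ (w : InfinitePlace K) (k : 𝓞 K), k ∈ 𝔭.asIdeal ↔ ‖ι'.symm (w.embedding (k : K))‖ < 1) →
      (∀ ℓ : ℕ, ℓ.Prime → ℓ ∣ N → ∃ v : HeightOneSpectrum (𝓞 K), Ideal.absNorm v.asIdeal = ℓ) →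
      κ.IsAnticyclotomic → κ.IsTopGenerator γ →
      ∀ (A : ℝ) (ΩK C : ℂ) (Ωp : ℂ_[3]) (Q : PowerSeries (PadicComplexInt 3)),
        0 < A → ΩK ≠ 0 → ‖((ι'.symm C : PadicAlgCl 3) : ℂ_[3])‖ = 1 → ‖Ωp‖ = 1 →
        IsHsiehLFunction ι' 𝔭 κ γ f A ΩK C Ωp Q →
        ∃ Ω : ℂ, Ω ≠ 0 ∧
          ∀ (τ : PadicAlgCl 3 ≃ₐ[ℚ_[3]] PadicAlgCl 3) (σ : ℂ ≃ₐ[ℚ] ℂ),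
            (∀ ζ : PadicAlgCl 3, (∃ m : ℕ, 0 < m ∧ ¬ 3 ∣ m ∧ ζ ^ m = 1) → τ ζ = ζ) →
            (∀ z : PadicAlgCl 3, σ (ι' z) = ι' (τ z)) →
            ∀ (χ : HeckeCharacter K) (n : ℕ), 0 < n →
              (∀ v : HeightOneSpectrum (𝓞 K), χ.IsUnramifiedAt v) →
              ∀ hχ : χ.HasInfinityType (fun _ ↦ (n : ℤ)) (fun _ ↦ -(n : ℤ)),
                ∀ r : FramedGaloisRep K (PadicAlgCl 3) 1, IsPAdicAvatarOf ι' χ r → FactorsThroughZp κ r →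
                  σ (bdpInterpolationValue 3 f 𝔭 χ n Ω) =
                    bdpInterpolationValue 3 f 𝔭 (hχ.autConj σ) n Ω) :
    Summit.BirchSwinnertonDyer.BirchSwinnertonDyer.Theses.ClassRecordThree.HsiehDescentAtThree := by
  intro W _ _ _
  exact ⟨fun _ _ ↦ hsiehDescentAt₃_of_inertialReciprocity_of_tateSenInertia W hTS (hVR W),
    fun _ _ ↦ hsiehDescentAt₃_of_inertialReciprocity_of_tateSenInertia W hTS (hVR W)⟩

/-- **Crux 19108 from {Tate–Sen (inertia form), inertial value reciprocity at every GLOBALLY MINIMAL elliptic `W`}** —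
the hypothesis in the exact binder shape of a route child `∀ W [W.IsElliptic] [W.IsGloballyMinimal], …` (the crux only
speaks about minimal models). CONDITIONAL; item 19108 OPEN. [cite: BrinonConrad2009, Thm. 2.2.7] -/
theorem classRecordThree_hsiehDescentAtThree_of_tateSenInertia_of_inertialReciprocityMinimal
    (hTS : TateSenInertiaVanishing 3)
    (hVR : ∀ (W : WeierstrassCurve ℚ) [W.IsElliptic] [W.IsGloballyMinimal],
  ∀ (ι' : PadicAlgCl 3 ≃+* ℂ) (K : Type) [Field K] [NumberField K]
      (𝔭 : HeightOneSpectrum (𝓞 K)) (κ : ZpExtension K 3) (γ : Field.absoluteGaloisGroup K)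
      {N : ℕ} [NeZero N] {f : CuspForm (CongruenceSubgroup.Gamma0 N) 2}, IsNewformOf W f →
      ClassX11b W 3 → Surj W 3 → W.conductorNorm ℤ = N → IsImaginaryQuadratic K →
      Odd (NumberField.discr K) → SatisfiesHeegnerHypothesis N K →
      ((Ideal.span {(3 : ℤ)}).primesOver (𝓞 K)).ncard = 2 → ((3 : ℕ) : 𝓞 K) ∈ 𝔭.asIdeal →
      𝔭.asIdeal.ramificationIdx (𝓞 ℚ) = 1 → 𝔭.asIdeal.inertiaDeg (𝓞 ℚ) = 1 →
      (∀ (w : InfinitePlace K) (k : 𝓞 K), k ∈ 𝔭.asIdeal ↔ ‖ι'.symm (w.embedding (k : K))‖ < 1) →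
      (∀ ℓ : ℕ, ℓ.Prime → ℓ ∣ N → ∃ v : HeightOneSpectrum (𝓞 K), Ideal.absNorm v.asIdeal = ℓ) →
      κ.IsAnticyclotomic → κ.IsTopGenerator γ →
      ∀ (A : ℝ) (ΩK C : ℂ) (Ωp : ℂ_[3]) (Q : PowerSeries (PadicComplexInt 3)),
        0 < A → ΩK ≠ 0 → ‖((ι'.symm C : PadicAlgCl 3) : ℂ_[3])‖ = 1 → ‖Ωp‖ = 1 →
        IsHsiehLFunction ι' 𝔭 κ γ f A ΩK C Ωp Q →
        ∃ Ω : ℂ, Ω ≠ 0 ∧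
          ∀ (τ : PadicAlgCl 3 ≃ₐ[ℚ_[3]] PadicAlgCl 3) (σ : ℂ ≃ₐ[ℚ] ℂ),
            (∀ ζ : PadicAlgCl 3, (∃ m : ℕ, 0 < m ∧ ¬ 3 ∣ m ∧ ζ ^ m = 1) → τ ζ = ζ) →
            (∀ z : PadicAlgCl 3, σ (ι' z) = ι' (τ z)) →
            ∀ (χ : HeckeCharacter K) (n : ℕ), 0 < n →
              (∀ v : HeightOneSpectrum (𝓞 K), χ.IsUnramifiedAt v) →
              ∀ hχ : χ.HasInfinityType (fun _ ↦ (n : ℤ)) (fun _ ↦ -(n : ℤ)),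
                ∀ r : FramedGaloisRep K (PadicAlgCl 3) 1, IsPAdicAvatarOf ι' χ r → FactorsThroughZp κ r →
                  σ (bdpInterpolationValue 3 f 𝔭 χ n Ω) =
                    bdpInterpolationValue 3 f 𝔭 (hχ.autConj σ) n Ω) :
    Summit.BirchSwinnertonDyer.BirchSwinnertonDyer.Theses.ClassRecordThree.HsiehDescentAtThree := by
  intro W _ _ _
  exact ⟨fun _ _ ↦ hsiehDescentAt₃_of_inertialReciprocity_of_tateSenInertia W hTS (hVR W),
    fun _ _ ↦ hsiehDescentAt₃_of_inertialReciprocity_of_tateSenInertia W hTS (hVR W)⟩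

/-- **The `KolyvaginRoadThree` copy of the crux from the same two inputs** (shared item 19108).
[cite: BrinonConrad2009, Thm. 2.2.7] -/
theorem kolyvaginRoadThree_hsiehDescentAtThree_of_tateSenInertia_of_inertialReciprocity
    (hTS : TateSenInertiaVanishing 3)
    (hVR : ∀ (W : WeierstrassCurve ℚ) [W.IsElliptic],
  ∀ (ι' : PadicAlgCl 3 ≃+* ℂ) (K : Type) [Field K] [NumberField K]
      (𝔭 : HeightOneSpectrum (𝓞 K)) (κ : ZpExtension K 3) (γ : Field.absoluteGaloisGroup K)
      {N : ℕ} [NeZero N] {f : CuspForm (CongruenceSubgroup.Gamma0 N) 2}, IsNewformOf W f →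
      ClassX11b W 3 → Surj W 3 → W.conductorNorm ℤ = N → IsImaginaryQuadratic K →
      Odd (NumberField.discr K) → SatisfiesHeegnerHypothesis N K →
      ((Ideal.span {(3 : ℤ)}).primesOver (𝓞 K)).ncard = 2 → ((3 : ℕ) : 𝓞 K) ∈ 𝔭.asIdeal →
      𝔭.asIdeal.ramificationIdx (𝓞 ℚ) = 1 → 𝔭.asIdeal.inertiaDeg (𝓞 ℚ) = 1 →
      (∀ (w : InfinitePlace K) (k : 𝓞 K), k ∈ 𝔭.asIdeal ↔ ‖ι'.symm (w.embedding (k : K))‖ < 1) →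
      (∀ ℓ : ℕ, ℓ.Prime → ℓ ∣ N → ∃ v : HeightOneSpectrum (𝓞 K), Ideal.absNorm v.asIdeal = ℓ) →
      κ.IsAnticyclotomic → κ.IsTopGenerator γ →
      ∀ (A : ℝ) (ΩK C : ℂ) (Ωp : ℂ_[3]) (Q : PowerSeries (PadicComplexInt 3)),
        0 < A → ΩK ≠ 0 → ‖((ι'.symm C : PadicAlgCl 3) : ℂ_[3])‖ = 1 → ‖Ωp‖ = 1 →
        IsHsiehLFunction ι' 𝔭 κ γ f A ΩK C Ωp Q →
        ∃ Ω : ℂ, Ω ≠ 0 ∧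
          ∀ (τ : PadicAlgCl 3 ≃ₐ[ℚ_[3]] PadicAlgCl 3) (σ : ℂ ≃ₐ[ℚ] ℂ),
            (∀ ζ : PadicAlgCl 3, (∃ m : ℕ, 0 < m ∧ ¬ 3 ∣ m ∧ ζ ^ m = 1) → τ ζ = ζ) →
            (∀ z : PadicAlgCl 3, σ (ι' z) = ι' (τ z)) →
            ∀ (χ : HeckeCharacter K) (n : ℕ), 0 < n →
              (∀ v : HeightOneSpectrum (𝓞 K), χ.IsUnramifiedAt v) →
              ∀ hχ : χ.HasInfinityType (fun _ ↦ (n : ℤ)) (fun _ ↦ -(n : ℤ)),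
                ∀ r : FramedGaloisRep K (PadicAlgCl 3) 1, IsPAdicAvatarOf ι' χ r → FactorsThroughZp κ r →
                  σ (bdpInterpolationValue 3 f 𝔭 χ n Ω) =
                    bdpInterpolationValue 3 f 𝔭 (hχ.autConj σ) n Ω) :
    Summit.BirchSwinnertonDyer.BirchSwinnertonDyer.Theses.KolyvaginRoadThree.HsiehDescentAtThree := by
  intro W _ _ _
  exact ⟨fun _ _ ↦ hsiehDescentAt₃_of_inertialReciprocity_of_tateSenInertia W hTS (hVR W),
    fun _ _ ↦ hsiehDescentAt₃_of_inertialReciprocity_of_tateSenInertia W hTS (hVR W)⟩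

/-- **Crux-level IFF: modulo `TateSenInertiaVanishing 3`, item 19108 `HsiehDescentAtThree` is EQUIVALENT to the
same statement with the node `Three.HsiehDescentAt₃ W` replaced by inertial value reciprocity** (both loci, same
guards). The archimedean input in inertial form is necessary and sufficient for the crux.
[cite: BrinonConrad2009, Thm. 2.2.7] -/
theorem classRecordThree_hsiehDescentAtThree_iff_inertialReciprocity (hTS : TateSenInertiaVanishing 3) :
    Summit.BirchSwinnertonDyer.BirchSwinnertonDyer.Theses.ClassRecordThree.HsiehDescentAtThree ↔
    ∀ (W : WeierstrassCurve ℚ) [W.IsElliptic] [W.IsGloballyMinimal], ClassX11b W 3 →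
      (Ram W 3 → W.HasSplitMultiplicativeReductionAtPrime 3 →
  ∀ (ι' : PadicAlgCl 3 ≃+* ℂ) (K : Type) [Field K] [NumberField K]
          (𝔭 : HeightOneSpectrum (𝓞 K)) (κ : ZpExtension K 3) (γ : Field.absoluteGaloisGroup K)
          {N : ℕ} [NeZero N] {f : CuspForm (CongruenceSubgroup.Gamma0 N) 2}, IsNewformOf W f →
          ClassX11b W 3 → Surj W 3 → W.conductorNorm ℤ = N → IsImaginaryQuadratic K →
          Odd (NumberField.discr K) → SatisfiesHeegnerHypothesis N K →
          ((Ideal.span {(3 : ℤ)}).primesOver (𝓞 K)).ncard = 2 → ((3 : ℕ) : 𝓞 K) ∈ 𝔭.asIdeal →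
          𝔭.asIdeal.ramificationIdx (𝓞 ℚ) = 1 → 𝔭.asIdeal.inertiaDeg (𝓞 ℚ) = 1 →
          (∀ (w : InfinitePlace K) (k : 𝓞 K), k ∈ 𝔭.asIdeal ↔ ‖ι'.symm (w.embedding (k : K))‖ < 1) →
          (∀ ℓ : ℕ, ℓ.Prime → ℓ ∣ N → ∃ v : HeightOneSpectrum (𝓞 K), Ideal.absNorm v.asIdeal = ℓ) →
          κ.IsAnticyclotomic → κ.IsTopGenerator γ →
          ∀ (A : ℝ) (ΩK C : ℂ) (Ωp : ℂ_[3]) (Q : PowerSeries (PadicComplexInt 3)),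
            0 < A → ΩK ≠ 0 → ‖((ι'.symm C : PadicAlgCl 3) : ℂ_[3])‖ = 1 → ‖Ωp‖ = 1 →
            IsHsiehLFunction ι' 𝔭 κ γ f A ΩK C Ωp Q →
            ∃ Ω : ℂ, Ω ≠ 0 ∧
              ∀ (τ : PadicAlgCl 3 ≃ₐ[ℚ_[3]] PadicAlgCl 3) (σ : ℂ ≃ₐ[ℚ] ℂ),
                (∀ ζ : PadicAlgCl 3, (∃ m : ℕ, 0 < m ∧ ¬ 3 ∣ m ∧ ζ ^ m = 1) → τ ζ = ζ) →
                (∀ z : PadicAlgCl 3, σ (ι' z) = ι' (τ z)) →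
                ∀ (χ : HeckeCharacter K) (n : ℕ), 0 < n →
                  (∀ v : HeightOneSpectrum (𝓞 K), χ.IsUnramifiedAt v) →
                  ∀ hχ : χ.HasInfinityType (fun _ ↦ (n : ℤ)) (fun _ ↦ -(n : ℤ)),
                    ∀ r : FramedGaloisRep K (PadicAlgCl 3) 1, IsPAdicAvatarOf ι' χ r → FactorsThroughZp κ r →
                      σ (bdpInterpolationValue 3 f 𝔭 χ n Ω) =
                        bdpInterpolationValue 3 f 𝔭 (hχ.autConj σ) n Ω) ∧
      (¬ Ram W 3 → Surj W 3 →
  ∀ (ι' : PadicAlgCl 3 ≃+* ℂ) (K : Type) [Field K] [NumberField K]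
          (𝔭 : HeightOneSpectrum (𝓞 K)) (κ : ZpExtension K 3) (γ : Field.absoluteGaloisGroup K)
          {N : ℕ} [NeZero N] {f : CuspForm (CongruenceSubgroup.Gamma0 N) 2}, IsNewformOf W f →
          ClassX11b W 3 → Surj W 3 → W.conductorNorm ℤ = N → IsImaginaryQuadratic K →
          Odd (NumberField.discr K) → SatisfiesHeegnerHypothesis N K →
          ((Ideal.span {(3 : ℤ)}).primesOver (𝓞 K)).ncard = 2 → ((3 : ℕ) : 𝓞 K) ∈ 𝔭.asIdeal →
          𝔭.asIdeal.ramificationIdx (𝓞 ℚ) = 1 → 𝔭.asIdeal.inertiaDeg (𝓞 ℚ) = 1 →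
          (∀ (w : InfinitePlace K) (k : 𝓞 K), k ∈ 𝔭.asIdeal ↔ ‖ι'.symm (w.embedding (k : K))‖ < 1) →
          (∀ ℓ : ℕ, ℓ.Prime → ℓ ∣ N → ∃ v : HeightOneSpectrum (𝓞 K), Ideal.absNorm v.asIdeal = ℓ) →
          κ.IsAnticyclotomic → κ.IsTopGenerator γ →
          ∀ (A : ℝ) (ΩK C : ℂ) (Ωp : ℂ_[3]) (Q : PowerSeries (PadicComplexInt 3)),
            0 < A → ΩK ≠ 0 → ‖((ι'.symm C : PadicAlgCl 3) : ℂ_[3])‖ = 1 → ‖Ωp‖ = 1 →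
            IsHsiehLFunction ι' 𝔭 κ γ f A ΩK C Ωp Q →
            ∃ Ω : ℂ, Ω ≠ 0 ∧
              ∀ (τ : PadicAlgCl 3 ≃ₐ[ℚ_[3]] PadicAlgCl 3) (σ : ℂ ≃ₐ[ℚ] ℂ),
                (∀ ζ : PadicAlgCl 3, (∃ m : ℕ, 0 < m ∧ ¬ 3 ∣ m ∧ ζ ^ m = 1) → τ ζ = ζ) →
                (∀ z : PadicAlgCl 3, σ (ι' z) = ι' (τ z)) →
                ∀ (χ : HeckeCharacter K) (n : ℕ), 0 < n →
                  (∀ v : HeightOneSpectrum (𝓞 K), χ.IsUnramifiedAt v) →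
                  ∀ hχ : χ.HasInfinityType (fun _ ↦ (n : ℤ)) (fun _ ↦ -(n : ℤ)),
                    ∀ r : FramedGaloisRep K (PadicAlgCl 3) 1, IsPAdicAvatarOf ι' χ r → FactorsThroughZp κ r →
                      σ (bdpInterpolationValue 3 f 𝔭 χ n Ω) =
                        bdpInterpolationValue 3 f 𝔭 (hχ.autConj σ) n Ω) := by
  constructor
  · intro h W _ _ hX
    obtain ⟨h₁, h₂⟩ := h W hX
    exact ⟨fun hr hs ↦ (hsiehDescentAt₃_iff_inertialReciprocity W hTS).1 (h₁ hr hs),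
      fun hr hs ↦ (hsiehDescentAt₃_iff_inertialReciprocity W hTS).1 (h₂ hr hs)⟩
  · intro h W _ _ hX
    obtain ⟨h₁, h₂⟩ := h W hX
    exact ⟨fun hr hs ↦ (hsiehDescentAt₃_iff_inertialReciprocity W hTS).2 (h₁ hr hs),
      fun hr hs ↦ (hsiehDescentAt₃_iff_inertialReciprocity W hTS).2 (h₂ hr hs)⟩

/-- **Item 19281 (`OpenValueReciprocityAtThree`, SHARP K5-B: exactness on the open subgroup `G_{ℚ₃(μ_m)}`)
implies inertial value reciprocity at every globally minimal elliptic `W`** (an inertial `τ` fixes `μ_m` for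
`3 ∤ m`; the extra binders `γ`, Hsieh witness are ignored). So the inertial form is WEAKER than the landed child
and everything landed on 19281 (p420148, p421735) transfers. [cite: BertoliniDarmonPrasanna2013, Thm. 5.5 (shape only; nothing asserted)] -/
theorem inertialReciprocity_of_openValueReciprocityAtThree
    (h : Summit.BirchSwinnertonDyer.BirchSwinnertonDyer.Theses.ClassRecordThree.OpenValueReciprocityAtThree)
    (W : WeierstrassCurve ℚ) [W.IsElliptic] [W.IsGloballyMinimal] :
  ∀ (ι' : PadicAlgCl 3 ≃+* ℂ) (K : Type) [Field K] [NumberField K]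
      (𝔭 : HeightOneSpectrum (𝓞 K)) (κ : ZpExtension K 3) (γ : Field.absoluteGaloisGroup K)
      {N : ℕ} [NeZero N] {f : CuspForm (CongruenceSubgroup.Gamma0 N) 2}, IsNewformOf W f →
      ClassX11b W 3 → Surj W 3 → W.conductorNorm ℤ = N → IsImaginaryQuadratic K →
      Odd (NumberField.discr K) → SatisfiesHeegnerHypothesis N K →
      ((Ideal.span {(3 : ℤ)}).primesOver (𝓞 K)).ncard = 2 → ((3 : ℕ) : 𝓞 K) ∈ 𝔭.asIdeal →
      𝔭.asIdeal.ramificationIdx (𝓞 ℚ) = 1 → 𝔭.asIdeal.inertiaDeg (𝓞 ℚ) = 1 →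
      (∀ (w : InfinitePlace K) (k : 𝓞 K), k ∈ 𝔭.asIdeal ↔ ‖ι'.symm (w.embedding (k : K))‖ < 1) →
      (∀ ℓ : ℕ, ℓ.Prime → ℓ ∣ N → ∃ v : HeightOneSpectrum (𝓞 K), Ideal.absNorm v.asIdeal = ℓ) →
      κ.IsAnticyclotomic → κ.IsTopGenerator γ →
      ∀ (A : ℝ) (ΩK C : ℂ) (Ωp : ℂ_[3]) (Q : PowerSeries (PadicComplexInt 3)),
        0 < A → ΩK ≠ 0 → ‖((ι'.symm C : PadicAlgCl 3) : ℂ_[3])‖ = 1 → ‖Ωp‖ = 1 →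
        IsHsiehLFunction ι' 𝔭 κ γ f A ΩK C Ωp Q →
        ∃ Ω : ℂ, Ω ≠ 0 ∧
          ∀ (τ : PadicAlgCl 3 ≃ₐ[ℚ_[3]] PadicAlgCl 3) (σ : ℂ ≃ₐ[ℚ] ℂ),
            (∀ ζ : PadicAlgCl 3, (∃ m : ℕ, 0 < m ∧ ¬ 3 ∣ m ∧ ζ ^ m = 1) → τ ζ = ζ) →
            (∀ z : PadicAlgCl 3, σ (ι' z) = ι' (τ z)) →
            ∀ (χ : HeckeCharacter K) (n : ℕ), 0 < n →
              (∀ v : HeightOneSpectrum (𝓞 K), χ.IsUnramifiedAt v) →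
              ∀ hχ : χ.HasInfinityType (fun _ ↦ (n : ℤ)) (fun _ ↦ -(n : ℤ)),
                ∀ r : FramedGaloisRep K (PadicAlgCl 3) 1, IsPAdicAvatarOf ι' χ r → FactorsThroughZp κ r →
                  σ (bdpInterpolationValue 3 f 𝔭 χ n Ω) =
                    bdpInterpolationValue 3 f 𝔭 (hχ.autConj σ) n Ω := by
  intro ι' K _ _ 𝔭 κ γ N _ f hf hX hSurj hN hKiq hodd hHeeg hsplit h3𝔭 hram hdeg hι𝔭 hℓ hκa _hγ A ΩK C Ωp Q
    _hA _hΩK _hC _hΩp _hQ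
  obtain ⟨Ω, hΩ, m, hm, h3m, hVR⟩ :=
    h W ι' K 𝔭 κ f hf hX hSurj hN hKiq hodd hHeeg hsplit h3𝔭 hram hdeg hι𝔭 hℓ hκa
  exact ⟨Ω, hΩ, fun τ σ hτ hστ χ n hn hunr hχ r hr hκr ↦
    hVR τ σ (fun ζ hζ ↦ hτ ζ ⟨m, hm, h3m, hζ⟩) hστ χ n hn hunr hχ r hr hκr⟩

/-- **End state of record for item 19108 with the inertia-form fact**: the crux from
{`TateSenInertiaVanishing 3`, `bertoliniDarmonPrasanna2013_centralValue_reciprocity`} — desc3-p1 g0's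
`classRecordThree_hsiehDescentAtThree_of_tateSen_of_bdp2013` (p421735) precomposed with
`tateSenCharacterVanishing_of_inertia`. CONDITIONAL on the two named facts. [cite: BrinonConrad2009, Thm. 2.2.7]
[cite: BertoliniDarmonPrasanna2013, Thm. 5.5] -/
theorem classRecordThree_hsiehDescentAtThree_of_tateSenInertia_of_bdp2013 (hTS : TateSenInertiaVanishing 3)
    (hBDP : bertoliniDarmonPrasanna2013_centralValue_reciprocity) :
    Summit.BirchSwinnertonDyer.BirchSwinnertonDyer.Theses.ClassRecordThree.HsiehDescentAtThree :=
  classRecordThree_hsiehDescentAtThree_of_tateSen_of_bdp2013 (tateSenCharacterVanishing_of_inertia 3 hTS) hBDP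


/-! ### The witness-free inertial K5-B (K5-B♭): item 19281 with `G_{ℚ₃(μ_m)}` replaced by the inertia group -/

/-- **K5-B♭ from item 19281.** K5-B♭ := the statement of `OpenValueReciprocityAtThree` (19281) VERBATIM with the
open subgroup «`∃ m, 0 < m ∧ 3 ∤ m ∧ ∀ τ fixing μ_m`» replaced by «`∀ τ` INERTIAL (fixing every root of unity of order
prime to `3`)» — weaker (an inertial `τ` fixes `μ_m`), witness-free, and print-derivable from the same sources (BDP13
Thm. 5.5 with `F = H(i)` unramified above `3`: an inertial `τ` fixes `ι′⁻¹(F)`, x11b3's T6). A candidate restatement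
of 19281 for the planner; nothing asserted. [cite: BertoliniDarmonPrasanna2013, Thm. 5.5 (shape only; nothing asserted)] -/
theorem inertialValueReciprocityFlat_of_openValueReciprocityAtThree
    (h : Summit.BirchSwinnertonDyer.BirchSwinnertonDyer.Theses.ClassRecordThree.OpenValueReciprocityAtThree) :
    ∀ (W : WeierstrassCurve ℚ) [W.IsElliptic] [W.IsGloballyMinimal], ∀ (ι' : PadicAlgCl 3 ≃+* ℂ) (K : Type) [Field
      K] [NumberField K] (𝔭 : IsDedekindDomain.HeightOneSpectrum (NumberField.RingOfIntegers K)) (κ :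
      Literature.NumberTheory.EllipticCurves.ZpExtension K 3) {N : ℕ} [NeZero N] (f : CuspForm
      (CongruenceSubgroup.Gamma0 N) 2), Literature.NumberTheory.EllipticCurves.ModularForms.IsNewformOf W f →
      Summit.BirchSwinnertonDyer.Rank1Residual.ClassX11b W 3 →
      Literature.NumberTheory.EllipticCurves.Rank1Residual.Surj W 3 → W.conductorNorm ℤ = N →
      Literature.NumberTheory.EllipticCurves.IsImaginaryQuadratic K → Odd (NumberField.discr K) →
      Literature.NumberTheory.EllipticCurves.SatisfiesHeegnerHypothesis N K → ((Ideal.span {(3 : ℤ)}).primesOver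
      (NumberField.RingOfIntegers K)).ncard = 2 → ((3 : ℕ) : NumberField.RingOfIntegers K) ∈ 𝔭.asIdeal →
      𝔭.asIdeal.ramificationIdx (NumberField.RingOfIntegers ℚ) = 1 → 𝔭.asIdeal.inertiaDeg
      (NumberField.RingOfIntegers ℚ) = 1 → (∀ (w : NumberField.InfinitePlace K) (k : NumberField.RingOfIntegers
      K), k ∈ 𝔭.asIdeal ↔ ‖ι'.symm (w.embedding (k : K))‖ < 1) → (∀ ℓ : ℕ, ℓ.Prime → ℓ ∣ N → ∃ v :
      IsDedekindDomain.HeightOneSpectrum (NumberField.RingOfIntegers K), Ideal.absNorm v.asIdeal = ℓ) →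
      κ.IsAnticyclotomic → ∃ Ω : ℂ, Ω ≠ 0 ∧ (∀ (τ : PadicAlgCl 3 ≃ₐ[ℚ_[3]] PadicAlgCl 3) (σ : ℂ ≃ₐ[ℚ] ℂ), (∀ ζ :
      PadicAlgCl 3, (∃ m : ℕ, 0 < m ∧ ¬ 3 ∣ m ∧ ζ ^ m = 1) → τ ζ = ζ) → (∀ z : PadicAlgCl 3, σ (ι' z) = ι' (τ z))
      → ∀ (χ : Literature.NumberTheory.GaloisRepresentations.HeckeCharacter K) (n : ℕ), 0 < n → (∀ v :
      IsDedekindDomain.HeightOneSpectrum (NumberField.RingOfIntegers K), χ.IsUnramifiedAt v) → ∀ hχ :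
      χ.HasInfinityType (fun _ ↦ (n : ℤ)) (fun _ ↦ -(n : ℤ)), ∀ r :
      Literature.NumberTheory.GaloisRepresentations.FramedGaloisRep K (PadicAlgCl 3) 1,
      Literature.NumberTheory.EllipticCurves.IsPAdicAvatarOf ι' χ r →
      Literature.NumberTheory.EllipticCurves.FactorsThroughZp κ r → σ
      (Literature.NumberTheory.EllipticCurves.bdpInterpolationValue 3 f 𝔭 χ n Ω) =
      Literature.NumberTheory.EllipticCurves.bdpInterpolationValue 3 f 𝔭 (hχ.autConj σ) n Ω) := by
  intro W _ _ ι' K _ _ 𝔭 κ N _ f hf hX hSurj hN hKiq hodd hHeeg hsplit h3𝔭 hram hdeg hι𝔭 hℓ hκa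
  obtain ⟨Ω, hΩ, m, hm, h3m, hVR⟩ :=
    h W ι' K 𝔭 κ f hf hX hSurj hN hKiq hodd hHeeg hsplit h3𝔭 hram hdeg hι𝔭 hℓ hκa
  exact ⟨Ω, hΩ, fun τ σ hτ hστ χ n hn hunr hχ r hr hκr ↦
    hVR τ σ (fun ζ hζ ↦ hτ ζ ⟨m, hm, h3m, hζ⟩) hστ χ n hn hunr hχ r hr hκr⟩

/-- **Crux 19108 from {the printed Tate–Sen theorem in inertia form, K5-B♭}.** K5-B♭ (witness-free, one period per
datum) implies inertial value reciprocity at every Hsieh witness trivially, so the inertial core applies on both loci.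
CONDITIONAL on both hypotheses; item 19108 stays OPEN. If the planner restates 19281 := K5-B♭ and 19238 :=
`TateSenInertiaVanishing 3`, the glue `HsiehDescentAtThreeOfChildren` is `fun h₁ h₂ ↦` this theorem `h₁ h₂`.
[cite: BrinonConrad2009, Thm. 2.2.7] -/
theorem classRecordThree_hsiehDescentAtThree_of_tateSenInertia_of_inertialValueReciprocityFlat
    (hTS : TateSenInertiaVanishing 3)
    (hVR :
    ∀ (W : WeierstrassCurve ℚ) [W.IsElliptic] [W.IsGloballyMinimal], ∀ (ι' : PadicAlgCl 3 ≃+* ℂ) (K : Type) [Field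
      K] [NumberField K] (𝔭 : IsDedekindDomain.HeightOneSpectrum (NumberField.RingOfIntegers K)) (κ :
      Literature.NumberTheory.EllipticCurves.ZpExtension K 3) {N : ℕ} [NeZero N] (f : CuspForm
      (CongruenceSubgroup.Gamma0 N) 2), Literature.NumberTheory.EllipticCurves.ModularForms.IsNewformOf W f →
      Summit.BirchSwinnertonDyer.Rank1Residual.ClassX11b W 3 →
      Literature.NumberTheory.EllipticCurves.Rank1Residual.Surj W 3 → W.conductorNorm ℤ = N →
      Literature.NumberTheory.EllipticCurves.IsImaginaryQuadratic K → Odd (NumberField.discr K) →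
      Literature.NumberTheory.EllipticCurves.SatisfiesHeegnerHypothesis N K → ((Ideal.span {(3 : ℤ)}).primesOver
      (NumberField.RingOfIntegers K)).ncard = 2 → ((3 : ℕ) : NumberField.RingOfIntegers K) ∈ 𝔭.asIdeal →
      𝔭.asIdeal.ramificationIdx (NumberField.RingOfIntegers ℚ) = 1 → 𝔭.asIdeal.inertiaDeg
      (NumberField.RingOfIntegers ℚ) = 1 → (∀ (w : NumberField.InfinitePlace K) (k : NumberField.RingOfIntegers
      K), k ∈ 𝔭.asIdeal ↔ ‖ι'.symm (w.embedding (k : K))‖ < 1) → (∀ ℓ : ℕ, ℓ.Prime → ℓ ∣ N → ∃ v :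
      IsDedekindDomain.HeightOneSpectrum (NumberField.RingOfIntegers K), Ideal.absNorm v.asIdeal = ℓ) →
      κ.IsAnticyclotomic → ∃ Ω : ℂ, Ω ≠ 0 ∧ (∀ (τ : PadicAlgCl 3 ≃ₐ[ℚ_[3]] PadicAlgCl 3) (σ : ℂ ≃ₐ[ℚ] ℂ), (∀ ζ :
      PadicAlgCl 3, (∃ m : ℕ, 0 < m ∧ ¬ 3 ∣ m ∧ ζ ^ m = 1) → τ ζ = ζ) → (∀ z : PadicAlgCl 3, σ (ι' z) = ι' (τ z))
      → ∀ (χ : Literature.NumberTheory.GaloisRepresentations.HeckeCharacter K) (n : ℕ), 0 < n → (∀ v :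
      IsDedekindDomain.HeightOneSpectrum (NumberField.RingOfIntegers K), χ.IsUnramifiedAt v) → ∀ hχ :
      χ.HasInfinityType (fun _ ↦ (n : ℤ)) (fun _ ↦ -(n : ℤ)), ∀ r :
      Literature.NumberTheory.GaloisRepresentations.FramedGaloisRep K (PadicAlgCl 3) 1,
      Literature.NumberTheory.EllipticCurves.IsPAdicAvatarOf ι' χ r →
      Literature.NumberTheory.EllipticCurves.FactorsThroughZp κ r → σ
      (Literature.NumberTheory.EllipticCurves.bdpInterpolationValue 3 f 𝔭 χ n Ω) =
      Literature.NumberTheory.EllipticCurves.bdpInterpolationValue 3 f 𝔭 (hχ.autConj σ) n Ω)) :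
    Summit.BirchSwinnertonDyer.BirchSwinnertonDyer.Theses.ClassRecordThree.HsiehDescentAtThree := by
  intro W _ _ _
  refine ⟨fun _ _ ↦ hsiehDescentAt₃_of_inertialReciprocity_of_tateSenInertia W hTS ?_,
    fun _ _ ↦ hsiehDescentAt₃_of_inertialReciprocity_of_tateSenInertia W hTS ?_⟩ <;>
  · intro ι' K _ _ 𝔭 κ γ N _ f hf hX hSurj hN hKiq hodd hHeeg hsplit h3𝔭 hram hdeg hι𝔭 hℓ hκa _ A ΩK C Ωp Q
      _ _ _ _ _
    exact hVR W ι' K 𝔭 κ f hf hX hSurj hN hKiq hodd hHeeg hsplit h3𝔭 hram hdeg hι𝔭 hℓ hκa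

/-- **The `KolyvaginRoadThree` copy of the crux from {Tate–Sen (inertia form), K5-B♭}.** [cite: BrinonConrad2009, Thm. 2.2.7] -/
theorem kolyvaginRoadThree_hsiehDescentAtThree_of_tateSenInertia_of_inertialValueReciprocityFlat
    (hTS : TateSenInertiaVanishing 3)
    (hVR :
    ∀ (W : WeierstrassCurve ℚ) [W.IsElliptic] [W.IsGloballyMinimal], ∀ (ι' : PadicAlgCl 3 ≃+* ℂ) (K : Type) [Field
      K] [NumberField K] (𝔭 : IsDedekindDomain.HeightOneSpectrum (NumberField.RingOfIntegers K)) (κ :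
      Literature.NumberTheory.EllipticCurves.ZpExtension K 3) {N : ℕ} [NeZero N] (f : CuspForm
      (CongruenceSubgroup.Gamma0 N) 2), Literature.NumberTheory.EllipticCurves.ModularForms.IsNewformOf W f →
      Summit.BirchSwinnertonDyer.Rank1Residual.ClassX11b W 3 →
      Literature.NumberTheory.EllipticCurves.Rank1Residual.Surj W 3 → W.conductorNorm ℤ = N →
      Literature.NumberTheory.EllipticCurves.IsImaginaryQuadratic K → Odd (NumberField.discr K) →
      Literature.NumberTheory.EllipticCurves.SatisfiesHeegnerHypothesis N K → ((Ideal.span {(3 : ℤ)}).primesOver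
      (NumberField.RingOfIntegers K)).ncard = 2 → ((3 : ℕ) : NumberField.RingOfIntegers K) ∈ 𝔭.asIdeal →
      𝔭.asIdeal.ramificationIdx (NumberField.RingOfIntegers ℚ) = 1 → 𝔭.asIdeal.inertiaDeg
      (NumberField.RingOfIntegers ℚ) = 1 → (∀ (w : NumberField.InfinitePlace K) (k : NumberField.RingOfIntegers
      K), k ∈ 𝔭.asIdeal ↔ ‖ι'.symm (w.embedding (k : K))‖ < 1) → (∀ ℓ : ℕ, ℓ.Prime → ℓ ∣ N → ∃ v :
      IsDedekindDomain.HeightOneSpectrum (NumberField.RingOfIntegers K), Ideal.absNorm v.asIdeal = ℓ) →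
      κ.IsAnticyclotomic → ∃ Ω : ℂ, Ω ≠ 0 ∧ (∀ (τ : PadicAlgCl 3 ≃ₐ[ℚ_[3]] PadicAlgCl 3) (σ : ℂ ≃ₐ[ℚ] ℂ), (∀ ζ :
      PadicAlgCl 3, (∃ m : ℕ, 0 < m ∧ ¬ 3 ∣ m ∧ ζ ^ m = 1) → τ ζ = ζ) → (∀ z : PadicAlgCl 3, σ (ι' z) = ι' (τ z))
      → ∀ (χ : Literature.NumberTheory.GaloisRepresentations.HeckeCharacter K) (n : ℕ), 0 < n → (∀ v :
      IsDedekindDomain.HeightOneSpectrum (NumberField.RingOfIntegers K), χ.IsUnramifiedAt v) → ∀ hχ :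
      χ.HasInfinityType (fun _ ↦ (n : ℤ)) (fun _ ↦ -(n : ℤ)), ∀ r :
      Literature.NumberTheory.GaloisRepresentations.FramedGaloisRep K (PadicAlgCl 3) 1,
      Literature.NumberTheory.EllipticCurves.IsPAdicAvatarOf ι' χ r →
      Literature.NumberTheory.EllipticCurves.FactorsThroughZp κ r → σ
      (Literature.NumberTheory.EllipticCurves.bdpInterpolationValue 3 f 𝔭 χ n Ω) =
      Literature.NumberTheory.EllipticCurves.bdpInterpolationValue 3 f 𝔭 (hχ.autConj σ) n Ω)) :
    Summit.BirchSwinnertonDyer.BirchSwinnertonDyer.Theses.KolyvaginRoadThree.HsiehDescentAtThree :=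
  classRecordThree_hsiehDescentAtThree_of_tateSenInertia_of_inertialValueReciprocityFlat hTS hVR

end Summit.BirchSwinnertonDyer.BirchSwinnertonDyer.Theorems

end
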